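import Literature.MathematicalPhysics.QuantumFieldTheory.Balaban1983to89.B1Eq324BenfattoKernelEq324AnyGammaUnitRange
import Literature.MathematicalPhysics.QuantumFieldTheory.Balaban1983to89.B1Eq324BenfattoKernelComparisonTwoMembers
import Literature.MathematicalPhysics.QuantumFieldTheory.Balaban1983to89.B1Eq324BenfattoSect5Eq515
import HarnessLib

/-!
# `Balaban1983to89.B1Eq324BenfattoClassMarginalTilt` — ONE LAW FOR ALL REGIONS AND BACKGROUNDS: the window MARGINAL of a member of
# the class of [Balaban1985BackgroundPropagators] Sect. E p. 428 is a member (Schur rows), the quadratic TILT to a prescribed precision on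
# the window is exact, and [Balaban1982Higgs1] (3.24) / [BenfattoEtAl1978] (4.6)–(4.7) TRANSPORTS from the prescribed member to the tilted
# region-box integral under the full-window law, PROVED

statement-level skeleton of published theorems with citation tags; proofs where landed; nothing here is a claim about the
Yang–Mills mass gap

WHY THIS MODULE (cell `pub-ymgap`, seat `dag-n08-d` gen 22, CLAIM-79; node N08 [Balaban1985UV3]; the [BenfattoEtAl1978] source chain behind
the (α)-row `h324`).  The class road proves (3.24) for the cut-off exponential moment `∫ Π_Δχ̂_Δ e^{H_J} d𝒩(0,K)` of every class member
`(Λ, A, K)` — `K = A⁻¹` zero-extended off the finite window `Λ ⊂ ℤ^d`, `A` symmetric, coercive, with exponentially decaying entries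
(seat n08-b's `…KernelEq324AnyGammaUnitRange.eq324_kernel_of_expDecay_on_unit`) —, and the Summits-side (α)-socket (seat n08-w4's
`…AlphaEq324RowClassSocket*`) plugs such a member into the step block `∫_{box h} e^{𝒱 h U} d(𝔖 k).μ` of the lane's carrier through a
PRESENTATION.  The carrier types ONE fluctuation law `(𝔖 k).μ` per step (ruling R-324), while print's Gaussian `dμ_{C^{(k)}}` of
[Balaban1985UV3] (58) p. 270 depends on the history and on the background «in covariance AND dimension» — seat n08-w4's located CHECK E
(`N08-SOCKET-END-A6-g6.md` §9), which offered either a carrier edition `μ : Hist → …` or a widening of the road's Hamiltonian class by a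
bounded quadratic part.  THIS FILE SHOWS NEITHER IS NEEDED.  Fix ONE full-window member `(Λ₀, A, K)` (e.g. the printed zero-background
fluctuation precision on ALL free bonds, seat n08-d's `…ClassTorusGaugeFluctuation`).  For a region `I ⊆ Λ₀`:
(M) the `I`-MARGINAL of `𝒩(0,K)` is `𝒩(0, S⁻¹)` with `S = (K_II)⁻¹ = A_II − A_{IIᶜ}(A_{IᶜIᶜ})⁻¹A_{IᶜI}` (block inversion,
[HornJohnson2013] §0.7.3), and `S` is again a class member — symmetric, coercive with the SAME constant, entries exponentially decaying
(the tree's Combes–Thomas bound `…ClassAppendixC.abs_inv_submatrix_apply_le_exp` for the block inverse, the triangle inequality for the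
two flanking factors) —, so the DIMENSION mismatch is no mismatch: an observable of the region variables integrates against the marginal;
(T) the quadratic TILT `e^{−½⟨y,(A₁−S)y⟩}` turns `𝒩(0,S⁻¹)` into ANY prescribed `𝒩(0,A₁⁻¹)` on the region up to the explicit constant
`Z_{A₁}/Z_S` (Gaussian densities, `GaussianToolkit.multivariateGaussian_inv_eq_withDensity`), so the COVARIANCE mismatch is a term of the
potential: with `𝒱 := H + Q + c`, `Q(z) = −½Σ_{u,v∈I}(A₁ − S)_{uv} z_u z_v`, `c = log(Z_S/Z_{A₁})`, the region-box integral of `e^{𝒱}`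
under the full-window law `𝒩(0,K)` IS the road's `∫ Π_Δχ̂_Δ e^{H} d𝒩(0,K₁)` for the member `(I, A₁, K₁)` — and (3.24) for that member
(the road, with N06's rows for `A₁` at a general background, or hypothesis-free at the trivial one) is LITERALLY the same sentence for the
tilted integral.  No carrier edition; no off-region Appendix-A tail (CHECK E (i)); no widened Hamiltonian class (CHECK E (ii)).

THE PRINTED TEXT this serves.  [Balaban1985UV3] (58) p. 270: the `k`-th step integral `∫ dμ_{C^{(k)}}(A′) χ_k … exp{…}` with
«`dμ_{C^{(k)}}` a Gaussian measure with a covariance having an exponential decay property (and many other properties, see Sect. E in [5])»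
(p. 261) on the fluctuation variables of the CURRENT region; (24) p. 262 «we apply the cumulant expansion formula (3.24) [8]».
[BenfattoEtAl1978] (4.6)–(4.7) p. 152 (the Lemma), Appendix C p. 164 (Gaussian conditioning; here its dual, marginalisation).
The block-inverse identity is [HornJohnson2013] §0.7.3 (0.7.3.1); the rest is OUR bookkeeping for the class (marked «class form; ours»).

WHAT IS PROVED (theorems only; no definition, no named fact, no `sorry`; axioms standard).
* §1 (any finite index set `ι`, `I : Finset ι`, `G = A⁻¹`): `precision_block_II` (the `II` block of `A·A⁻¹ = 1`),
  ★ `inv_covGram_inv_eq_schur` (`(G_II)⁻¹ = A_II − A_{IIᶜ}(A|_{Iᶜ})⁻¹A_{IᶜI}`), `inv_covGram_inv_symm`,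
  ★ `inv_covGram_inv_coercive` (`γ`-coercive with `A`'s constant), ★ `abs_inv_covGram_inv_sub_le`
  (`|S_{uv} − A_{uv}| ≤ (γ − J)⁻¹ΣΣ|A_{uz}|e^{−κ·dist z z′}|A_{z′v}|`), ★★ `abs_inv_covGram_inv_sub_le_exp` / `abs_inv_covGram_inv_le_exp`
  (`|S_{uv} − A_{uv}| ≤ (M²/(γ − J))e^{−κ·dist u v}` under the weighted rows `Σ_{e′}|A e e′|e^{κ·dist e e′} ≤ M`) — THE MARGINAL IS A MEMBER.
* §2 (any finite `ι`; positive definite `S, A₁`): `gaussWeight_mul_gaussWeight_sub` (`w_S·w_{A₁−S} = w_{A₁}`),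
  ★★ `lintegral_mul_gaussWeight_tilt_eq` (`∫⁻ F·w_{A₁−S} dN(0,S⁻¹) = Z_S⁻¹Z_{A₁}·∫⁻ F dN(0,A₁⁻¹)`) — THE TILT.
* §3 (`Q₀ = ℤ^d`; `(Λ₀, A, K)` zero-extended inverse of a positive definite `A`, `I ⊆ Λ₀`): ★ `lintegral_eq_lintegral_marginal`
  (an observable of the `I`-coordinates integrates against `N(0, ((K_II)⁻¹)⁻¹)` on the window), `posDef_inv_covGram`,
  `cutoffBoltzmann_ext_eq_indicator` (on configurations vanishing off `I` the road's `Π_Δχ̂^I_pΔ e^{H}` IS print's box indicator times `e^{H}`).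
* §4 ★★★ `lintegral_printBox_tilt_eq_mul` — for measurable `H` reading only the `I`-coordinates and `p ≥ 0`:
  `∫⁻ 𝟙{∀x∈I, |z_x| ≤ p}·e^{H + Q} d𝒩(0,K) = Z_S⁻¹Z_{A₁}·∫⁻ Π_Δχ̂^I_pΔ e^{H} d𝒩(0,K₁)`; ★★★ `integral_printBox_exp_tilt_eq` (Bochner, with the
  constant `c = log(Z_S/Z_{A₁})` inside the exponent: EQUALITY of the two integrals); ★★★ `integral_printBox_exp_tilt_hamiltonian_eq`
  (`H = H_J` of (4.5), `J ⊆ I`); ★★ `eq324Shape_tilt_iff` (the road's conclusion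
  `0 < ∫… ∧ |log ∫… − Σ_{n≤t}ℰ^T(H;n)/n!| ≤ E` for the member `(I, A₁, K₁)` is the same sentence for the tilted box integral under `𝒩(0,K)`).
* §5 ★★ `eq324_tilt_of_expDecay_on_unit` — seat n08-b's END restated: the integral is taken against ONE full-window law `𝒩(0,K)` of ANY
  positive definite `A` on `Λ₀ ⊇ I`, the class rows (symmetry, `γ_A`-coercivity, `K_A e^{−κ_A|·|₂}` decay) are asked of the region member `A₁`
  only, window `b₁ < b₀`, all `η ∈ (0,1]`, constants from the class scalars; `coercive_submatrix_of_injective` (principal blocks along an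
  injective index map keep the ellipticity constant); ★★★ `eq324_tilt_submatrix_of_expDecay_on_unit` — ONE CLASS MEMBER PRESENTS (3.24) FOR ALL
  ITS REGIONS: the region member is the principal block `A|_I` (rows inherited, no further hypothesis), so a single class member `(Λ₀, A, K)` —
  at the zero background the presented `C*Δ_kC` of seat n08-d's `…ClassTorusGaugeFluctuation`, hypothesis-free — serves every region `I ⊆ Λ₀`.
* §6 (v1.1, APPEND-ONLY; referee dag-ref-G READ437 NIT-1/NIT-2 folded in the docstrings above) ★★ `eq324_tilt_of_expDecay` — the `η₀`-WINDOW EDITION of §5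
  (fixed `b₀ > 0`; `∃ η₀ ∈ (0,1], C ≥ 0, ∀ η ≤ η₀`) over seat n08-b's `…KernelEq324AnyGamma.eq324_kernel_of_expDecay`, for the `η₀`-route sockets.

HONEST SCOPE.  Gaussian and matrix bookkeeping for OUR class + one composition by name; which `A`, `I(h)`, `A₁(h,U)` present
[Balaban1985UV3]'s step (NODE 00's pins; N06's rows at a general background) is NOT decided, commissioned or claimed here; nothing of
[Balaban1985UV3] / [Balaban1985UV2] / [BenfattoEtAl1978] is asserted beyond what the cited tree theorems PROVE; `PrintedUV3V` / row `h324c` NOT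
discharged; N08 NOT discharged; count-neutral; one finite torus per run at fixed spacing — nothing about d = 4 continuum limits, OS axioms, a
mass gap or the Clay problem.

References: [Balaban1985UV3] T. Bałaban, CMP 102 (1985) 255–275 — (24) p. 262, (58) p. 270, p. 261; [Balaban1982Higgs1] T. Bałaban, CMP 85
(1982) 603–636 — (3.24) p. 616; [BenfattoEtAl1978] G. Benfatto, M. Cassandro, G. Gallavotti, F. Nicolò, E. Olivieri, E. Presutti,
E. Scacciatelli, CMP 59 (1978) 143–166 — Lemma p. 152, Appendix C p. 164; [Balaban1985BackgroundPropagators] T. Bałaban, CMP 99 (1985) 389–434 —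
Sect. E p. 428; [HornJohnson2013] R. A. Horn, C. R. Johnson, *Matrix Analysis*, 2nd ed., CUP 2013 — §0.7.3, §7.1.
-/

noncomputable section

open MeasureTheory ProbabilityTheory Finset Matrix WithLp
open scoped BigOperators Matrix NNReal ENNReal

namespace Literature.MathematicalPhysics.QuantumFieldTheory.Balaban1983to89.B1Eq324BenfattoClassMarginalTilt

open Literature.MathematicalPhysics.QuantumFieldTheory
open Literature.MathematicalPhysics.QuantumFieldTheory.GaussianToolkit
open Literature.MathematicalPhysics.QuantumFieldTheory.Balaban1983to89.B1Eq324BenfattoLemma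
open Literature.MathematicalPhysics.QuantumFieldTheory.Balaban1983to89.B1Eq324BenfattoKernelOfPrecision
open Literature.MathematicalPhysics.QuantumFieldTheory.Balaban1983to89.B1Eq324BenfattoKernelComparison
open Literature.MathematicalPhysics.QuantumFieldTheory.Balaban1983to89.B1Eq324BenfattoClassAppendixC
open Literature.MathematicalPhysics.QuantumFieldTheory.Balaban1983to89.B1Eq324BenfattoClassDecoupling
open Literature.MathematicalPhysics.QuantumFieldTheory.Balaban1983to89.B1Eq324BenfattoKernelComparisonTwoMembers
  (lintegral_eq_lintegral_window)
open Literature.MathematicalPhysics.QuantumFieldTheory.Balaban1983to89.B1Eq324BenfattoSect5Iteration (measurable_cutoffBoltzmann_hamiltonian)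
open Literature.MathematicalPhysics.QuantumFieldTheory.Balaban1983to89.B1Eq324BenfattoSect5Eq515 (hamiltonian_congr_eqOn measurable_hamiltonian)
open Literature.MathematicalPhysics.QuantumFieldTheory.Balaban1983to89.B1Eq324BenfattoKernelEq324AnyGammaUnitRange
  (eq324_kernel_of_expDecay_on_unit)

variable {d : ℕ}

/-! ## §1  The marginal precision `S = (G_II)⁻¹` of a class member is a class member (any finite index set) -/

section Marginal

variable {ι : Type*} [Fintype ι] [DecidableEq ι] {A : Matrix ι ι ℝ}

omit [DecidableEq ι] in
/-- The quadratic form in double-sum currency. [cite: HornJohnson2013, §0.7.2] -/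
private theorem dot_form_eq (B : Matrix ι ι ℝ) (x : ι → ℝ) :
    x ⬝ᵥ B *ᵥ x = ∑ y, ∑ y', B y y' * x y * x y' := by
  simp only [dotProduct, Matrix.mulVec, Finset.mul_sum]
  exact Finset.sum_congr rfl fun y _ => Finset.sum_congr rfl fun y' _ => by ring

/-- The `II` block of `A·A⁻¹ = 1`: `A_{II}G_{II} + A_{IIᶜ}G_{IᶜI} = 1` (`G = A⁻¹`; `G_{II}` is the tree's Gram matrix `covGram G I`).
[cite: HornJohnson2013, §0.7.3 (inverse of a partitioned matrix, (0.7.3.1))] -/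
theorem precision_block_II (hA : IsUnit A.det) (I : Finset ι) :
    A.submatrix (fun j : I => (j : ι)) (fun j : I => (j : ι)) * covGram (A⁻¹ : Matrix ι ι ℝ) I +
        A.submatrix (fun j : I => (j : ι)) (fun j : ↥Iᶜ => (j : ι)) *
          A⁻¹.submatrix (fun j : ↥Iᶜ => (j : ι)) (fun j : I => (j : ι)) = 1 := by
  have hcov : covGram (A⁻¹ : Matrix ι ι ℝ) I = A⁻¹.submatrix (fun j : I => (j : ι)) (fun j : I => (j : ι)) := by
    ext s t; rfl
  rw [hcov, submatrix_mul_add_submatrix_compl_mul, Matrix.mul_nonsing_inv A hA]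
  ext y y'
  simp only [Matrix.submatrix_apply, Matrix.one_apply, Subtype.ext_iff]

/-- ★ **THE MARGINAL PRECISION IS A SCHUR COMPLEMENT**: for positive definite `A` with covariance `G = A⁻¹` and any `I`,
`(G_{II})⁻¹ = A_{II} − A_{IIᶜ}(A|_{Iᶜ})⁻¹A_{IᶜI}` — the precision of the `I`-marginal `𝒩(0, G_{II})` of `𝒩(0, G)` is the Schur
complement of the deleted block (dual of Appendix C's conditioning, where the conditional covariance is `(A|_{Iᶜ})⁻¹`).
[cite: HornJohnson2013, §0.7.3 (0.7.3.1); BenfattoEtAl1978, Appendix C 2) p.164 (class form, dual; ours)] -/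
theorem inv_covGram_inv_eq_schur (hA : A.PosDef) (I : Finset ι) :
    (covGram (A⁻¹ : Matrix ι ι ℝ) I)⁻¹ =
      A.submatrix (fun j : I => (j : ι)) (fun j : I => (j : ι)) -
        A.submatrix (fun j : I => (j : ι)) (fun j : ↥Iᶜ => (j : ι)) *
            (A.submatrix (fun j : ↥Iᶜ => (j : ι)) (fun j : ↥Iᶜ => (j : ι)))⁻¹ *
          A.submatrix (fun j : ↥Iᶜ => (j : ι)) (fun j : I => (j : ι)) := by
  have hdetA : IsUnit A.det := (Matrix.isUnit_iff_isUnit_det A).mp hA.isUnit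
  have hB := isUnit_det_submatrix_compl hA I
  set B := A.submatrix (fun j : ↥Iᶜ => (j : ι)) (fun j : ↥Iᶜ => (j : ι)) with hBdef
  set AII := A.submatrix (fun j : I => (j : ι)) (fun j : I => (j : ι)) with hAII
  set AIc := A.submatrix (fun j : I => (j : ι)) (fun j : ↥Iᶜ => (j : ι)) with hAIc
  set AcI := A.submatrix (fun j : ↥Iᶜ => (j : ι)) (fun j : I => (j : ι)) with hAcI
  set GII := covGram (A⁻¹ : Matrix ι ι ℝ) I with hGII
  set GcI := A⁻¹.submatrix (fun j : ↥Iᶜ => (j : ι)) (fun j : I => (j : ι)) with hGcI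
  have h1 : AcI * GII + B * GcI = 0 := precision_block_cΓ hdetA I
  have h2 : AII * GII + AIc * GcI = 1 := precision_block_II hdetA I
  have hGcI' : GcI = -(B⁻¹ * (AcI * GII)) := by
    have h : B * GcI = -(AcI * GII) := eq_neg_of_add_eq_zero_right h1
    calc GcI = B⁻¹ * (B * GcI) := by rw [← Matrix.mul_assoc, Matrix.nonsing_inv_mul _ hB, Matrix.one_mul]
      _ = -(B⁻¹ * (AcI * GII)) := by rw [h, Matrix.mul_neg]
  have hS : (AII - AIc * B⁻¹ * AcI) * GII = 1 := by
    rw [Matrix.sub_mul, Matrix.mul_assoc, Matrix.mul_assoc, ← h2, hGcI', Matrix.mul_neg, sub_eq_add_neg]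
  exact Matrix.inv_eq_left_inv hS

/-- The marginal precision is symmetric when `A` is. [cite: HornJohnson2013, §0.7.3] -/
theorem inv_covGram_inv_symm (hAs : ∀ e e', A e e' = A e' e) (I : Finset ι) (s s' : I) :
    (covGram (A⁻¹ : Matrix ι ι ℝ) I)⁻¹ s s' = (covGram (A⁻¹ : Matrix ι ι ℝ) I)⁻¹ s' s := by
  have hAt : Aᵀ = A := by ext i j; exact hAs j i
  have hGt : (A⁻¹ : Matrix ι ι ℝ)ᵀ = A⁻¹ := by rw [Matrix.transpose_nonsing_inv, hAt]
  have hCt : (covGram (A⁻¹ : Matrix ι ι ℝ) I)ᵀ = covGram (A⁻¹ : Matrix ι ι ℝ) I := by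
    ext a b
    rw [Matrix.transpose_apply, covGram_apply, covGram_apply]
    have h := congrFun (congrFun hGt a) b
    rw [Matrix.transpose_apply] at h
    exact h
  have h := Matrix.transpose_nonsing_inv (covGram (A⁻¹ : Matrix ι ι ℝ) I)
  rw [hCt] at h
  have h2 := congrFun (congrFun h s') s
  rw [Matrix.transpose_apply] at h2
  exact h2

/-- ★ **THE MARGINAL KEEPS THE ELLIPTICITY CONSTANT**: if `A` is symmetric and `γ`-coercive (`γ > 0`), then `(G_{II})⁻¹` is
`γ`-coercive for every `I` (`G = A⁻¹ ≤ γ⁻¹` as a form, so is its `I`-block, and the inverse of a form `≤ γ⁻¹` is `≥ γ`: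
`GaussianToolkit.inv_form_bounds`, `…ClassAppendixC.coercive_inv_of_form_le`).
[cite: HornJohnson2013, Thm 4.3.28 with §7.1; BenfattoEtAl1978, Appendix C (C.2)–(C.4) p.164 (class form, dual; ours)] -/
theorem inv_covGram_inv_coercive (hAs : ∀ e e', A e e' = A e' e) {γ : ℝ} (hγ0 : 0 < γ)
    (hγ : ∀ x : ι → ℝ, γ * ∑ e, x e ^ 2 ≤ ∑ e, ∑ e', A e e' * x e * x e') (I : Finset ι) (z : I → ℝ) :
    γ * ∑ s, z s ^ 2 ≤ ∑ s, ∑ s', (covGram (A⁻¹ : Matrix ι ι ℝ) I)⁻¹ s s' * z s * z s' := by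
  have hPD : A.PosDef := posDef_of_coercive hAs hγ0 hγ
  have hnorm : ∀ v : ι → ℝ, ‖(WithLp.toLp 2 v : EuclideanSpace ℝ ι)‖ ^ 2 = ∑ e, v e ^ 2 := fun v =>
    EuclideanSpace.real_norm_sq_eq _
  have hlow : ∀ v : ι → ℝ, γ * ‖(WithLp.toLp 2 v : EuclideanSpace ℝ ι)‖ ^ 2 ≤ v ⬝ᵥ A *ᵥ v := by
    intro v; rw [hnorm, dot_form_eq]; exact hγ v
  -- a crude upper form bound `C = Σ|A e e′|` (finite index set)
  set C : ℝ := ∑ e, ∑ e', |A e e'| with hC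
  have hup : ∀ v : ι → ℝ, v ⬝ᵥ A *ᵥ v ≤ C * ‖(WithLp.toLp 2 v : EuclideanSpace ℝ ι)‖ ^ 2 := by
    intro v
    rw [hnorm, dot_form_eq]
    have hN : ∀ e, v e ^ 2 ≤ ∑ e', v e' ^ 2 := fun e =>
      Finset.single_le_sum (fun e' _ => sq_nonneg (v e')) (Finset.mem_univ e)
    have hterm : ∀ e e', A e e' * v e * v e' ≤ |A e e'| * ∑ e'', v e'' ^ 2 := by
      intro e e'
      have h1 : A e e' * v e * v e' ≤ |A e e'| * (|v e| * |v e'|) := by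
        rw [← abs_mul (v e), ← abs_mul]
        calc A e e' * v e * v e' = A e e' * (v e * v e') := by ring
          _ ≤ |A e e' * (v e * v e')| := le_abs_self _
      have h2 : |v e| * |v e'| ≤ ∑ e'', v e'' ^ 2 := by
        have := hN e; have := hN e'
        nlinarith [sq_nonneg (|v e| - |v e'|), sq_abs (v e), sq_abs (v e'), abs_nonneg (v e), abs_nonneg (v e')]
      exact h1.trans (mul_le_mul_of_nonneg_left h2 (abs_nonneg _))
    calc ∑ e, ∑ e', A e e' * v e * v e' ≤ ∑ e, ∑ e', |A e e'| * ∑ e'', v e'' ^ 2 :=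
          Finset.sum_le_sum fun e _ => Finset.sum_le_sum fun e' _ => hterm e e'
      _ = C * ∑ e'', v e'' ^ 2 := by
          rw [hC, Finset.sum_mul]
          exact Finset.sum_congr rfl fun e _ => by rw [Finset.sum_mul]
  -- the empty window is trivial; otherwise the index set is nonempty and `C ≥ γ > 0`
  rcases I.eq_empty_or_nonempty with hI | ⟨i₀, -⟩
  · have huniv : (Finset.univ : Finset ↥I) = ∅ := Finset.univ_eq_empty_iff.mpr (Finset.isEmpty_coe_sort.mpr hI)
    rw [huniv, Finset.sum_empty, Finset.sum_empty, mul_zero]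
  have hCpos : 0 < C := by
    have h1 := hlow (fun e => if e = i₀ then 1 else 0)
    have h2 := hup (fun e => if e = i₀ then 1 else 0)
    have hn : ‖(WithLp.toLp 2 (fun e => if e = i₀ then (1 : ℝ) else 0) : EuclideanSpace ℝ ι)‖ ^ 2 = 1 := by
      rw [hnorm]; simp [Finset.sum_ite_eq']
    rw [hn] at h1 h2
    linarith
  -- `G = A⁻¹`: `C⁻¹`-coercive and `≤ γ⁻¹` as a form
  have hG := fun v => inv_form_bounds hPD hγ0 hlow hup v
  set G : Matrix ι ι ℝ := A⁻¹ with hGdef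
  have hGs : ∀ e e', G e e' = G e' e := by
    intro e e'
    have hAt : Aᵀ = A := by ext i j; exact hAs j i
    have h := Matrix.transpose_nonsing_inv A
    rw [hAt] at h
    have h2 := congrFun (congrFun h e') e
    rw [Matrix.transpose_apply] at h2
    exact h2
  -- the `I`-block `G_II = covGram G I`
  have hblock : ∀ w : I → ℝ, ∑ s, ∑ s', covGram (A⁻¹ : Matrix ι ι ℝ) I s s' * w s * w s' =
      extendJ I w ⬝ᵥ G *ᵥ extendJ I w := by
    intro w
    rw [← dotProduct_submatrix_mulVec G w, dot_form_eq]
    rfl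
  have hnormJ : ∀ w : I → ℝ, ‖(WithLp.toLp 2 (extendJ I w) : EuclideanSpace ℝ ι)‖ ^ 2 = ∑ s, w s ^ 2 := by
    intro w
    rw [hnorm]
    have := sum_mul_extendJ w (extendJ I w)
    simp_rw [← sq] at this
    rw [this]
    exact Finset.sum_congr rfl fun s _ => by rw [extendJ_apply_coe, sq]
  have hGIIs : ∀ s s' : I, covGram (A⁻¹ : Matrix ι ι ℝ) I s s' = covGram (A⁻¹ : Matrix ι ι ℝ) I s' s := fun s s' => by
    rw [covGram_apply, covGram_apply]; exact hGs s s'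
  have hGIIlow : ∀ w : I → ℝ, C⁻¹ * ∑ s, w s ^ 2 ≤ ∑ s, ∑ s', covGram (A⁻¹ : Matrix ι ι ℝ) I s s' * w s * w s' := by
    intro w; rw [hblock, ← hnormJ]; exact (hG (extendJ I w)).1
  have hGIIup : ∀ w : I → ℝ, ∑ s, ∑ s', covGram (A⁻¹ : Matrix ι ι ℝ) I s s' * w s * w s' ≤ γ⁻¹ * ∑ s, w s ^ 2 := by
    intro w; rw [hblock, ← hnormJ]; exact (hG (extendJ I w)).2
  have h := coercive_inv_of_form_le hGIIs (inv_pos.mpr hCpos) hGIIlow hGIIup z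
  rw [one_div, inv_inv] at h
  exact h

/-- **The marginal correction, entrywise**: `(G_{II})⁻¹_{uv} − A_{uv} = −Σ_{z,z′∉I} A_{uz}((A|_{Iᶜ})⁻¹)_{zz′}A_{z′v}`.
[cite: HornJohnson2013, §0.7.3 (0.7.3.1)] -/
theorem inv_covGram_inv_sub_apply (hA : A.PosDef) (I : Finset ι) (u v : I) :
    (covGram (A⁻¹ : Matrix ι ι ℝ) I)⁻¹ u v - A u v =
      -∑ z : ↥Iᶜ, ∑ z' : ↥Iᶜ,
        A u z * (A.submatrix (fun j : ↥Iᶜ => (j : ι)) (fun j : ↥Iᶜ => (j : ι)))⁻¹ z z' * A z' v := by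
  rw [inv_covGram_inv_eq_schur hA I, Matrix.sub_apply, Matrix.submatrix_apply, sub_sub_cancel_left, Matrix.mul_apply,
    neg_inj]
  simp_rw [Matrix.mul_apply, Matrix.submatrix_apply, Finset.sum_mul]
  rw [Finset.sum_comm]

/-- ★ **The marginal correction is controlled by the DECAYING block inverse**: with the class hypotheses of
`…ClassAppendixC.abs_inv_apply_le_exp` (pseudometric `dist`; `A` symmetric, `γ`-coercive, Combes–Thomas rows `≤ J < γ` at rate `κ ≥ 0`),
`|(G_{II})⁻¹_{uv} − A_{uv}| ≤ (γ − J)⁻¹ Σ_{z,z′∉I} |A_{uz}| e^{−κ·dist z z′} |A_{z′v}|` — uniformly in `I`.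
[cite: BenfattoEtAl1978, Appendix C (C.6) p.164 (class form, dual; ours)] -/
theorem abs_inv_covGram_inv_sub_le (hAs : ∀ e e', A e e' = A e' e) {dist : ι → ι → ℝ}
    (hd0 : ∀ e, dist e e = 0) (hdsymm : ∀ e e', dist e e' = dist e' e)
    (hdtri : ∀ e e' e'', dist e e'' ≤ dist e e' + dist e' e'')
    {γ J κ : ℝ} (hγ0 : 0 < γ)
    (hγ : ∀ x : ι → ℝ, γ * ∑ e, x e ^ 2 ≤ ∑ e, ∑ e', A e e' * x e * x e')
    (hJ : ∀ e, ∑ e', |A e e'| * (Real.cosh (κ * dist e e') - 1) ≤ J) (hκ : 0 ≤ κ) (hm : J < γ)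
    (I : Finset ι) (u v : I) :
    |(covGram (A⁻¹ : Matrix ι ι ℝ) I)⁻¹ u v - A u v| ≤
      1 / (γ - J) * ∑ z : ↥Iᶜ, ∑ z' : ↥Iᶜ, |A u z| * Real.exp (-(κ * dist z z')) * |A z' v| := by
  have hγJ : 0 < γ - J := by linarith
  rw [inv_covGram_inv_sub_apply (posDef_of_coercive hAs hγ0 hγ) I u v, abs_neg, Finset.mul_sum]
  refine (Finset.abs_sum_le_sum_abs _ _).trans (Finset.sum_le_sum fun z _ => ?_)
  rw [Finset.mul_sum]
  refine (Finset.abs_sum_le_sum_abs _ _).trans (Finset.sum_le_sum fun z' _ => ?_)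
  rw [abs_mul, abs_mul]
  have h1 := abs_inv_submatrix_apply_le_exp hAs hd0 hdsymm hdtri hγ0 hγ hJ hκ hm Iᶜ z z'
  calc |A u z| * |(A.submatrix (fun j : ↥Iᶜ => (j : ι)) (fun j : ↥Iᶜ => (j : ι)))⁻¹ z z'| * |A z' v|
      ≤ |A u z| * (Real.exp (-(κ * dist z z')) / (γ - J)) * |A z' v| :=
        mul_le_mul_of_nonneg_right (mul_le_mul_of_nonneg_left h1 (abs_nonneg _)) (abs_nonneg _)
    _ = 1 / (γ - J) * (|A u z| * Real.exp (-(κ * dist z z')) * |A z' v|) := by ring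

/-- ★★ **EXPONENTIAL DECAY OF THE MARGINAL CORRECTION**: if moreover the rows of `A` are exponentially weighted-summable,
`Σ_{e′} |A e e′| e^{κ·dist e e′} ≤ M`, then `|(G_{II})⁻¹_{uv} − A_{uv}| ≤ (M²/(γ − J))·e^{−κ·dist u v}` for every `I` and `u, v ∈ I`
(triangle inequality through the two flanking entries). [cite: BenfattoEtAl1978, Appendix C (C.6)–(C.7) p.164 (class form, dual; ours)] -/
theorem abs_inv_covGram_inv_sub_le_exp (hAs : ∀ e e', A e e' = A e' e) {dist : ι → ι → ℝ}
    (hd0 : ∀ e, dist e e = 0) (hdsymm : ∀ e e', dist e e' = dist e' e)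
    (hdtri : ∀ e e' e'', dist e e'' ≤ dist e e' + dist e' e'')
    {γ J κ : ℝ} (hγ0 : 0 < γ)
    (hγ : ∀ x : ι → ℝ, γ * ∑ e, x e ^ 2 ≤ ∑ e, ∑ e', A e e' * x e * x e')
    (hJ : ∀ e, ∑ e', |A e e'| * (Real.cosh (κ * dist e e') - 1) ≤ J) (hκ : 0 ≤ κ) (hm : J < γ)
    {M : ℝ} (hM : ∀ e, ∑ e', |A e e'| * Real.exp (κ * dist e e') ≤ M) (I : Finset ι) (u v : I) :
    |(covGram (A⁻¹ : Matrix ι ι ℝ) I)⁻¹ u v - A u v| ≤ M ^ 2 / (γ - J) * Real.exp (-(κ * dist u v)) := by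
  have hγJ : 0 < γ - J := by linarith
  have hM0 : 0 ≤ M :=
    le_trans (Finset.sum_nonneg fun e' _ => mul_nonneg (abs_nonneg _) (Real.exp_pos _).le) (hM u)
  refine (abs_inv_covGram_inv_sub_le hAs hd0 hdsymm hdtri hγ0 hγ hJ hκ hm I u v).trans ?_
  have hterm : ∀ z z' : ι, |A u z| * Real.exp (-(κ * dist z z')) * |A z' v| ≤
      Real.exp (-(κ * dist u v)) * ((|A u z| * Real.exp (κ * dist u z)) * (|A v z'| * Real.exp (κ * dist v z'))) := by
    intro z z'
    have htri : dist (u : ι) v ≤ dist u z + dist z z' + dist v z' := by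
      have h1 := hdtri (u : ι) z' v
      have h2 := hdtri (u : ι) z z'
      rw [hdsymm z' v] at h1
      linarith
    have hexp : Real.exp (-(κ * dist z z')) ≤
        Real.exp (-(κ * dist u v)) * (Real.exp (κ * dist u z) * Real.exp (κ * dist v z')) := by
      rw [← Real.exp_add, ← Real.exp_add, Real.exp_le_exp]
      nlinarith [mul_le_mul_of_nonneg_left htri hκ]
    rw [hAs z' v]
    calc |A u z| * Real.exp (-(κ * dist z z')) * |A v z'|
        = (|A u z| * |A v z'|) * Real.exp (-(κ * dist z z')) := by ring
      _ ≤ (|A u z| * |A v z'|) * (Real.exp (-(κ * dist u v)) * (Real.exp (κ * dist u z) * Real.exp (κ * dist v z'))) :=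
          mul_le_mul_of_nonneg_left hexp (mul_nonneg (abs_nonneg _) (abs_nonneg _))
      _ = _ := by ring
  have hsum : ∑ z : ↥Iᶜ, ∑ z' : ↥Iᶜ, |A u z| * Real.exp (-(κ * dist z z')) * |A z' v| ≤
      Real.exp (-(κ * dist u v)) * (M * M) := by
    calc ∑ z : ↥Iᶜ, ∑ z' : ↥Iᶜ, |A u z| * Real.exp (-(κ * dist z z')) * |A z' v|
        ≤ ∑ z : ↥Iᶜ, ∑ z' : ↥Iᶜ, Real.exp (-(κ * dist u v)) *
            ((|A u z| * Real.exp (κ * dist u z)) * (|A v z'| * Real.exp (κ * dist v z'))) :=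
          Finset.sum_le_sum fun z _ => Finset.sum_le_sum fun z' _ => hterm z z'
      _ = Real.exp (-(κ * dist u v)) * ((∑ z : ↥Iᶜ, |A u z| * Real.exp (κ * dist u z)) *
            (∑ z' : ↥Iᶜ, |A v z'| * Real.exp (κ * dist v z'))) := by
          rw [Finset.sum_mul_sum, Finset.mul_sum]
          refine Finset.sum_congr rfl fun z _ => ?_
          rw [Finset.mul_sum]
      _ ≤ Real.exp (-(κ * dist u v)) * (M * M) := by
          refine mul_le_mul_of_nonneg_left ?_ (Real.exp_pos _).le
          have hz : ∑ z : ↥Iᶜ, |A u z| * Real.exp (κ * dist u z) ≤ M := by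
            rw [Finset.sum_coe_sort Iᶜ (fun z => |A u z| * Real.exp (κ * dist u z))]
            exact le_trans (Finset.sum_le_univ_sum_of_nonneg fun z => mul_nonneg (abs_nonneg _) (Real.exp_pos _).le) (hM u)
          have hz' : ∑ z' : ↥Iᶜ, |A v z'| * Real.exp (κ * dist v z') ≤ M := by
            rw [Finset.sum_coe_sort Iᶜ (fun z' => |A v z'| * Real.exp (κ * dist v z'))]
            exact le_trans (Finset.sum_le_univ_sum_of_nonneg fun z => mul_nonneg (abs_nonneg _) (Real.exp_pos _).le) (hM v)
          exact mul_le_mul hz hz' (Finset.sum_nonneg fun _ _ => mul_nonneg (abs_nonneg _) (Real.exp_pos _).le) hM0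
  calc 1 / (γ - J) * ∑ z : ↥Iᶜ, ∑ z' : ↥Iᶜ, |A u z| * Real.exp (-(κ * dist z z')) * |A z' v|
      ≤ 1 / (γ - J) * (Real.exp (-(κ * dist u v)) * (M * M)) := mul_le_mul_of_nonneg_left hsum (by positivity)
    _ = M ^ 2 / (γ - J) * Real.exp (-(κ * dist u v)) := by ring

/-- ★★ **THE MARGINAL IS A MEMBER — entrywise decay of `(G_{II})⁻¹` with explicit constants**: if the entries of `A` decay,
`|A e e′| ≤ K_A e^{−κ·dist e e′}`, then `|(G_{II})⁻¹_{uv}| ≤ (K_A + M²/(γ − J))·e^{−κ·dist u v}` for every window `I` — together with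
`inv_covGram_inv_symm` and `inv_covGram_inv_coercive` the three class rows the road asks of a member, with constants independent of `I`.
[cite: Balaban1985BackgroundPropagators, Sect. E p.428 (the class); BenfattoEtAl1978, Appendix C p.164 (class form, dual; ours)] -/
theorem abs_inv_covGram_inv_le_exp (hAs : ∀ e e', A e e' = A e' e) {dist : ι → ι → ℝ}
    (hd0 : ∀ e, dist e e = 0) (hdsymm : ∀ e e', dist e e' = dist e' e)
    (hdtri : ∀ e e' e'', dist e e'' ≤ dist e e' + dist e' e'')
    {γ J κ : ℝ} (hγ0 : 0 < γ)
    (hγ : ∀ x : ι → ℝ, γ * ∑ e, x e ^ 2 ≤ ∑ e, ∑ e', A e e' * x e * x e')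
    (hJ : ∀ e, ∑ e', |A e e'| * (Real.cosh (κ * dist e e') - 1) ≤ J) (hκ : 0 ≤ κ) (hm : J < γ)
    {M KA : ℝ} (hM : ∀ e, ∑ e', |A e e'| * Real.exp (κ * dist e e') ≤ M)
    (hdec : ∀ e e', |A e e'| ≤ KA * Real.exp (-(κ * dist e e'))) (I : Finset ι) (u v : I) :
    |(covGram (A⁻¹ : Matrix ι ι ℝ) I)⁻¹ u v| ≤ (KA + M ^ 2 / (γ - J)) * Real.exp (-(κ * dist u v)) := by
  have h := abs_inv_covGram_inv_sub_le_exp hAs hd0 hdsymm hdtri hγ0 hγ hJ hκ hm hM I u v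
  have htri : |(covGram (A⁻¹ : Matrix ι ι ℝ) I)⁻¹ u v| ≤ |(covGram (A⁻¹ : Matrix ι ι ℝ) I)⁻¹ u v - A u v| + |A u v| := by
    have := abs_add_le ((covGram (A⁻¹ : Matrix ι ι ℝ) I)⁻¹ u v - A u v) (A u v)
    rwa [sub_add_cancel] at this
  calc |(covGram (A⁻¹ : Matrix ι ι ℝ) I)⁻¹ u v|
      ≤ M ^ 2 / (γ - J) * Real.exp (-(κ * dist u v)) + KA * Real.exp (-(κ * dist u v)) :=
        htri.trans (add_le_add h (hdec u v))
    _ = (KA + M ^ 2 / (γ - J)) * Real.exp (-(κ * dist u v)) := by ring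

end Marginal

/-! ## §2  The quadratic tilt between two centred Gaussians on one finite index set -/

section Tilt

variable {ι : Type*} [Fintype ι] [DecidableEq ι]

omit [DecidableEq ι] in
/-- **Gaussian weights multiply**: `e^{−½⟨y,Sy⟩}·e^{−½⟨y,(A₁−S)y⟩} = e^{−½⟨y,A₁y⟩}`. [cite: HornJohnson2013, §7.1 (quadratic forms); folklore] -/
theorem gaussWeight_mul_gaussWeight_sub (S A₁ : Matrix ι ι ℝ) (y : EuclideanSpace ℝ ι) :
    gaussWeight S y * gaussWeight (A₁ - S) y = gaussWeight A₁ y := by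
  simp only [gaussWeight]
  rw [← ENNReal.ofReal_mul (Real.exp_pos _).le, ← Real.exp_add]
  congr 2
  rw [Matrix.sub_mulVec, dotProduct_sub]
  ring

/-- ★★ **THE TILT**: for positive definite `S, A₁` on one finite index set and measurable `F ≥ 0`,
`∫⁻ F(y)·e^{−½⟨y,(A₁−S)y⟩} dN(0,S⁻¹)(y) = Z_S⁻¹·Z_{A₁}·∫⁻ F dN(0,A₁⁻¹)` — multiplying the density of `N(0,S⁻¹)` by the quadratic tilt gives
the density of `N(0,A₁⁻¹)` up to the ratio of the normalisations (`GaussianToolkit.multivariateGaussian_inv_eq_withDensity`).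
[cite: HornJohnson2013, §7.1; BenfattoEtAl1978, §1 (1.1) p.144 (Gaussian densities; class form; ours)] -/
theorem lintegral_mul_gaussWeight_tilt_eq {S A₁ : Matrix ι ι ℝ} (hS : S.PosDef) (hA₁ : A₁.PosDef)
    {F : EuclideanSpace ℝ ι → ℝ≥0∞} (hF : Measurable F) :
    ∫⁻ y, F y * gaussWeight (A₁ - S) y ∂multivariateGaussian 0 S⁻¹ =
      (gaussZ S)⁻¹ * gaussZ A₁ * ∫⁻ y, F y ∂multivariateGaussian 0 A₁⁻¹ := by
  obtain ⟨-, hZ0, hZtop⟩ := multivariateGaussian_inv_eq_withDensity hA₁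
  rw [lintegral_multivariateGaussian_inv_eq hS (fun y => F y * gaussWeight (A₁ - S) y) (hF.mul (measurable_gaussWeight _)),
    lintegral_multivariateGaussian_inv_eq hA₁ F hF]
  have hpt : ∀ y, gaussWeight S y * (F y * gaussWeight (A₁ - S) y) = gaussWeight A₁ y * F y := by
    intro y
    rw [mul_comm (F y), ← mul_assoc, gaussWeight_mul_gaussWeight_sub]
  simp_rw [hpt]
  rw [← mul_assoc, mul_assoc (gaussZ S)⁻¹, ENNReal.mul_inv_cancel hZ0 hZtop, mul_one]

end Tilt

/-! ## §3  The window: marginal law of a zero-extended member, and the road's cut-off on configurations vanishing off the window -/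

section Window

variable {Λ₀ : Finset (B1Eq324BenfattoLemma.Site d)} {A : Matrix Λ₀ Λ₀ ℝ}
  {K : B1Eq324BenfattoLemma.Site d → B1Eq324BenfattoLemma.Site d → ℝ}
  (hK : ∀ x y, K x y = if h : x ∈ Λ₀ ∧ y ∈ Λ₀ then (A⁻¹ : Matrix Λ₀ Λ₀ ℝ) ⟨x, h.1⟩ ⟨y, h.2⟩ else 0)

/-- The extension-by-zero of a window configuration is measurable. [folklore] -/
private theorem measurable_ext (I : Finset (B1Eq324BenfattoLemma.Site d)) :
    Measurable fun (w : I → ℝ) (x : B1Eq324BenfattoLemma.Site d) => if h : x ∈ I then w ⟨x, h⟩ else 0 := by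
  refine measurable_pi_lambda _ fun x => ?_
  by_cases h : x ∈ I
  · simp only [dif_pos h]
    exact measurable_pi_apply _
  · simp only [dif_neg h]
    exact measurable_const

/-- **On a configuration vanishing off `I`, the road's small-field event `Π_Δχ̂^I_pΔ` (thresholds `p(1 + d(I,Δ))`) IS print's box
`{|z_x| ≤ p, x ∈ I}`** (`p ≥ 0`: on `I` the threshold is `p`, off `I` the coordinate is `0`).
[cite: BenfattoEtAl1978, (A.1) p.161; Balaban1985UV3, (18) p.260 «χ(|A(b)| < g₀p(g₀))» (class form; ours)] -/
theorem mem_smallFieldSet_iff_of_eq_zero_off {I : Finset (B1Eq324BenfattoLemma.Site d)} {p : ℝ} (hp : 0 ≤ p)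
    {z : B1Eq324BenfattoLemma.Site d → ℝ} (hz : ∀ x, x ∉ I → z x = 0) :
    z ∈ smallFieldSet I p ↔ ∀ x ∈ I, |z x| ≤ p := by
  constructor
  · intro h x hx
    have h' := h x
    rwa [B1Eq324BenfattoSect5SlotMoments.distToRegion_eq_zero_of_mem hx, add_zero, mul_one] at h'
  · intro h x
    show |z x| ≤ p * (1 + distToRegion I x)
    by_cases hx : x ∈ I
    · rw [B1Eq324BenfattoSect5SlotMoments.distToRegion_eq_zero_of_mem hx, add_zero, mul_one]
      exact h x hx
    · rw [hz x hx, abs_zero]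
      exact mul_nonneg hp (by linarith [B1Eq324BenfattoAppendixA.distToRegion_nonneg I x])

/-- **The road's integrand on the extension by zero**: `(Π_Δχ̂^I_pΔ e^{H})(ext w) = 𝟙{∀u, |w_u| ≤ p}·e^{H(ext w)}` (`p ≥ 0`).
[cite: BenfattoEtAl1978, (4.6)–(4.7) p.152 with (A.1) p.161 (class form; ours)] -/
theorem cutoffBoltzmann_ext_eq_indicator (I : Finset (B1Eq324BenfattoLemma.Site d)) {p : ℝ} (hp : 0 ≤ p)
    (H : (B1Eq324BenfattoLemma.Site d → ℝ) → ℝ) (w : I → ℝ) :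
    cutoffBoltzmann H I p (fun x => if h : x ∈ I then w ⟨x, h⟩ else 0) =
      {w' : I → ℝ | ∀ u, |w' u| ≤ p}.indicator
        (fun w' => Real.exp (H (fun x => if h : x ∈ I then w' ⟨x, h⟩ else 0))) w := by
  have hz : ∀ x, x ∉ I → (fun x => if h : x ∈ I then w ⟨x, h⟩ else 0) x = 0 := fun x hx => by
    simp only [dif_neg hx]
  have hiff : (fun x => if h : x ∈ I then w ⟨x, h⟩ else 0) ∈ smallFieldSet I p ↔ w ∈ {w' : I → ℝ | ∀ u, |w' u| ≤ p} := by
    rw [mem_smallFieldSet_iff_of_eq_zero_off hp hz, Set.mem_setOf_eq]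
    constructor
    · intro h u
      have h' := h u u.2
      simp only [dif_pos u.2, Subtype.coe_eta] at h'
      exact h'
    · intro h x hx
      simp only [dif_pos hx]
      exact h ⟨x, hx⟩
  unfold cutoffBoltzmann
  by_cases hmem : w ∈ {w' : I → ℝ | ∀ u, |w' u| ≤ p}
  · rw [Set.indicator_of_mem (hiff.mpr hmem), Set.indicator_of_mem hmem]
  · rw [Set.indicator_of_notMem (fun h => hmem (hiff.mp h)), Set.indicator_of_notMem hmem]

include hK

/-- The inverse Gram block `S = (K_{II})⁻¹` of a member on a sub-window `I ⊆ Λ₀` is positive definite.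
[cite: HornJohnson2013, Obs. 7.1.2; BenfattoEtAl1978, Appendix C (C.6) p.164 (class form)] -/
theorem posDef_inv_covGram (hA : A.PosDef) {I : Finset (B1Eq324BenfattoLemma.Site d)} (hI : I ⊆ Λ₀) :
    ((covGram K I)⁻¹).PosDef :=
  (posDef_covGram_kernel hK hA hI).inv

/-- ★ **THE MARGINAL WINDOW LAW**: an observable `F ≥ 0` of `ℝ^{ℤ^d}` reading only the coordinates in `I ⊆ Λ₀` integrates, under the
full-window law `𝒩(0,K)` of the member `(Λ₀, A, K)`, as `∫⁻ F(ext y) dN(0, S⁻¹)(y)` with `S = (K_{II})⁻¹` THE MARGINAL PRECISION of §1 and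
`ext` the extension by zero — the dimension of the presented Gaussian is that of the REGION, whatever `Λ₀` is.
[cite: BenfattoEtAl1978, §1 p.144, Appendix C 2) p.164 (class form, dual; ours); Balaban1985UV3, (58) p.270] -/
theorem lintegral_eq_lintegral_marginal (hA : A.PosDef) {I : Finset (B1Eq324BenfattoLemma.Site d)} (hI : I ⊆ Λ₀)
    {F : (B1Eq324BenfattoLemma.Site d → ℝ) → ℝ≥0∞} (hF : Measurable F)
    (hloc : ∀ z z', (∀ x ∈ I, z x = z' x) → F z = F z') :
    ∫⁻ z, F z ∂gaussianFieldOfKernel K =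
      ∫⁻ y, F (fun x => if h : x ∈ I then (ofLp y : I → ℝ) ⟨x, h⟩ else 0)
        ∂multivariateGaussian 0 ((covGram K I)⁻¹)⁻¹ := by
  have hKpsd : IsPosSemidefKernel K := isPosSemidefKernel_kernel hK hA
  have hdet : IsUnit (covGram K I).det := isUnit_det_covGram_kernel hK hA hI
  have hG : Measurable fun w : I → ℝ => F (fun x => if h : x ∈ I then w ⟨x, h⟩ else 0) := hF.comp (measurable_ext I)
  rw [Matrix.nonsing_inv_nonsing_inv _ hdet]
  calc ∫⁻ z, F z ∂gaussianFieldOfKernel K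
      = ∫⁻ z, (fun w : I → ℝ => F (fun x => if h : x ∈ I then w ⟨x, h⟩ else 0)) (I.restrict z) ∂gaussianFieldOfKernel K := by
        refine lintegral_congr fun z => hloc _ _ fun x hx => ?_
        rw [dif_pos hx]
        rfl
    _ = _ := lintegral_comp_restrict_eq hKpsd I hG

end Window

/-! ## §4  The tilted region-box integral under ONE full-window law IS the road's cut-off integral for the region member -/

section Composite

variable {Λ₀ : Finset (B1Eq324BenfattoLemma.Site d)} {A : Matrix Λ₀ Λ₀ ℝ}
  {K : B1Eq324BenfattoLemma.Site d → B1Eq324BenfattoLemma.Site d → ℝ}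
  (hK : ∀ x y, K x y = if h : x ∈ Λ₀ ∧ y ∈ Λ₀ then (A⁻¹ : Matrix Λ₀ Λ₀ ℝ) ⟨x, h.1⟩ ⟨y, h.2⟩ else 0)
  {I : Finset (B1Eq324BenfattoLemma.Site d)} {A₁ : Matrix I I ℝ}
  {K₁ : B1Eq324BenfattoLemma.Site d → B1Eq324BenfattoLemma.Site d → ℝ}
  (hK₁ : ∀ x y, K₁ x y = if h : x ∈ I ∧ y ∈ I then (A₁⁻¹ : Matrix I I ℝ) ⟨x, h.1⟩ ⟨y, h.2⟩ else 0)

/-- Print's box `{|z_x| ≤ p, x ∈ I}` is a measurable event of `ℝ^{ℤ^d}`. [cite: Balaban1985UV3, (18) p.260 (class form; ours)] -/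
theorem measurableSet_printBox (I : Finset (B1Eq324BenfattoLemma.Site d)) (p : ℝ) :
    MeasurableSet {z : B1Eq324BenfattoLemma.Site d → ℝ | ∀ x ∈ I, |z x| ≤ p} := by
  have h : {z : B1Eq324BenfattoLemma.Site d → ℝ | ∀ x ∈ I, |z x| ≤ p} =
      ⋂ x ∈ (I : Set (B1Eq324BenfattoLemma.Site d)), {z : B1Eq324BenfattoLemma.Site d → ℝ | |z x| ≤ p} := by
    ext z
    simp only [Set.mem_setOf_eq, Set.mem_iInter, Finset.mem_coe]
  rw [h]
  exact Finset.measurableSet_biInter I fun x _ =>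
    measurableSet_le (continuous_abs.measurable.comp (measurable_pi_apply x)) measurable_const

/-- The tilt `Q(z) = −½Σ_{u,v∈I}(A₁ − S)_{uv} z_u z_v`, read off its displayed formula, is measurable (a finite sum of coordinate monomials).
[cite: Balaban1985UV3, (58) p.270 (the quadratic form `⟨A′, Δ^{(k)}A′⟩`; class form; ours)] -/
theorem measurable_tilt {S : Matrix I I ℝ} {Q : (B1Eq324BenfattoLemma.Site d → ℝ) → ℝ}
    (hQ : ∀ z, Q z = -(1 / 2) * ∑ u : I, ∑ v : I, (A₁ u v - S u v) * z u * z v) : Measurable Q := by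
  have h : Q = fun z => -(1 / 2) * ∑ u : I, ∑ v : I, (A₁ u v - S u v) * z u * z v := funext hQ
  rw [h]
  exact measurable_const.mul (Finset.measurable_sum _ fun u _ => Finset.measurable_sum _ fun v _ =>
    (measurable_const.mul (measurable_pi_apply _)).mul (measurable_pi_apply _))

include hK hK₁

/-- ★★★ **THE TILTED REGION-BOX INTEGRAL UNDER ONE LAW, `lintegral` currency.**  `(Λ₀, A, K)` the zero-extended inverse of a positive
definite `A` (ONE law for all regions), `I ⊆ Λ₀` a region, `(I, A₁, K₁)` ANY positive definite member on the region, `S = (K_{II})⁻¹` the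
marginal precision, `Q(z) = −½Σ_{u,v∈I}(A₁ − S)_{uv}z_u z_v` the tilt, `H` measurable reading only the `I`-coordinates, `p ≥ 0`.  Then
`∫⁻ 𝟙{∀x∈I, |z_x| ≤ p}·e^{H + Q} d𝒩(0,K) = Z_S⁻¹·Z_{A₁}·∫⁻ Π_Δχ̂^I_pΔ e^{H} d𝒩(0,K₁)` — marginal (§3) ∘ tilt (§2) ∘ window.
[cite: Balaban1985UV3, (58) p.270, (24) p.262; BenfattoEtAl1978, (4.6)–(4.7) p.152 (class form; ours)] -/
theorem lintegral_printBox_tilt_eq_mul (hA : A.PosDef) (hI : I ⊆ Λ₀) (hA₁ : A₁.PosDef)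
    {H : (B1Eq324BenfattoLemma.Site d → ℝ) → ℝ} (hHm : Measurable H)
    (hHloc : ∀ z z', (∀ x ∈ I, z x = z' x) → H z = H z') {p : ℝ} (hp : 0 ≤ p)
    {Q : (B1Eq324BenfattoLemma.Site d → ℝ) → ℝ}
    (hQ : ∀ z, Q z = -(1 / 2) * ∑ u : I, ∑ v : I, (A₁ u v - (covGram K I)⁻¹ u v) * z u * z v) :
    ∫⁻ z, ENNReal.ofReal ({z : B1Eq324BenfattoLemma.Site d → ℝ | ∀ x ∈ I, |z x| ≤ p}.indicator
        (fun z => Real.exp (H z + Q z)) z) ∂gaussianFieldOfKernel K =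
      (gaussZ (covGram K I)⁻¹)⁻¹ * gaussZ A₁ *
        ∫⁻ z, ENNReal.ofReal (cutoffBoltzmann H I p z) ∂gaussianFieldOfKernel K₁ := by
  set S : Matrix I I ℝ := (covGram K I)⁻¹ with hSdef
  have hS : S.PosDef := posDef_inv_covGram hK hA hI
  set box : Set (B1Eq324BenfattoLemma.Site d → ℝ) := {z | ∀ x ∈ I, |z x| ≤ p} with hbox
  set boxW : Set (I → ℝ) := {w' | ∀ u, |w' u| ≤ p} with hboxW
  have hQm : Measurable Q := measurable_tilt hQ
  have hboxm : MeasurableSet box := measurableSet_printBox I p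
  have hboxWm : MeasurableSet boxW := by
    have h : boxW = ⋂ u : I, {w' : I → ℝ | |w' u| ≤ p} := by
      ext w; simp only [hboxW, Set.mem_setOf_eq, Set.mem_iInter]
    rw [h]
    exact MeasurableSet.iInter fun u =>
      measurableSet_le (continuous_abs.measurable.comp (measurable_pi_apply u)) measurable_const
  -- the left integrand and its locality
  have hFm : Measurable fun z => ENNReal.ofReal (box.indicator (fun z => Real.exp (H z + Q z)) z) :=
    ENNReal.measurable_ofReal.comp (((hHm.add hQm).exp).indicator hboxm)
  have hQloc : ∀ z z' : B1Eq324BenfattoLemma.Site d → ℝ, (∀ x ∈ I, z x = z' x) → Q z = Q z' := by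
    intro z z' h
    rw [hQ z, hQ z']
    congr 1
    exact Finset.sum_congr rfl fun u _ => Finset.sum_congr rfl fun v _ => by rw [h _ u.2, h _ v.2]
  have hFloc : ∀ z z' : B1Eq324BenfattoLemma.Site d → ℝ, (∀ x ∈ I, z x = z' x) →
      ENNReal.ofReal (box.indicator (fun z => Real.exp (H z + Q z)) z) =
        ENNReal.ofReal (box.indicator (fun z => Real.exp (H z + Q z)) z') := by
    intro z z' h
    have hmem : z ∈ box ↔ z' ∈ box := by
      simp only [hbox, Set.mem_setOf_eq]
      exact ⟨fun hz x hx => (h x hx) ▸ hz x hx, fun hz x hx => (h x hx).symm ▸ hz x hx⟩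
    by_cases hz : z ∈ box
    · rw [Set.indicator_of_mem hz, Set.indicator_of_mem (hmem.mp hz), hHloc z z' h, hQloc z z' h]
    · rw [Set.indicator_of_notMem hz, Set.indicator_of_notMem (fun h' => hz (hmem.mpr h'))]
  -- §3: pass to the marginal on the window
  rw [lintegral_eq_lintegral_marginal hK hA hI hFm hFloc]
  -- the right side on the window of the member `(I, A₁, K₁)`
  have hCBm : Measurable fun z => ENNReal.ofReal (cutoffBoltzmann H I p z) := by
    refine ENNReal.measurable_ofReal.comp ?_
    unfold cutoffBoltzmann
    exact hHm.exp.indicator (measurableSet_smallFieldSet I p)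
  rw [lintegral_eq_lintegral_window hK₁ hA₁ hCBm]
  -- the window observable `G(w) = 𝟙_{boxW}(w)·e^{H(ext w)}`
  have hGm : Measurable fun y : EuclideanSpace ℝ I =>
      ENNReal.ofReal (boxW.indicator (fun w' => Real.exp (H (fun x => if h : x ∈ I then w' ⟨x, h⟩ else 0))) (ofLp y)) := by
    have h1 : Measurable fun w' : I → ℝ => Real.exp (H (fun x => if h : x ∈ I then w' ⟨x, h⟩ else 0)) :=
      (hHm.comp (measurable_ext I)).exp
    exact (ENNReal.measurable_ofReal.comp (h1.indicator hboxWm)).comp (MeasurableEquiv.toLp 2 (I → ℝ)).symm.measurable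
  -- pointwise on the window: left integrand = G · tilt weight; right integrand = G
  have hleft : ∀ y : EuclideanSpace ℝ I,
      ENNReal.ofReal (box.indicator (fun z => Real.exp (H z + Q z))
          (fun x => if h : x ∈ I then (ofLp y : I → ℝ) ⟨x, h⟩ else 0)) =
        ENNReal.ofReal (boxW.indicator (fun w' => Real.exp (H (fun x => if h : x ∈ I then w' ⟨x, h⟩ else 0))) (ofLp y)) *
          gaussWeight (A₁ - S) y := by
    intro y
    have hmem : (fun x => if h : x ∈ I then (ofLp y : I → ℝ) ⟨x, h⟩ else 0) ∈ box ↔ (ofLp y : I → ℝ) ∈ boxW := by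
      simp only [hbox, hboxW, Set.mem_setOf_eq]
      constructor
      · intro h u
        have h' := h u u.2
        simp only [dif_pos u.2, Subtype.coe_eta] at h'
        exact h'
      · intro h x hx
        simp only [dif_pos hx]
        exact h ⟨x, hx⟩
    by_cases hy : (ofLp y : I → ℝ) ∈ boxW
    · have hQy : Q (fun x => if h : x ∈ I then (ofLp y : I → ℝ) ⟨x, h⟩ else 0) = -(ofLp y ⬝ᵥ (A₁ - S) *ᵥ ofLp y) / 2 := by
        rw [hQ, dot_form_eq]
        simp only [Finset.coe_mem, dite_true, Subtype.coe_eta, Matrix.sub_apply]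
        ring
      rw [Set.indicator_of_mem (hmem.mpr hy), Set.indicator_of_mem hy, Real.exp_add,
        ENNReal.ofReal_mul (Real.exp_pos _).le, gaussWeight, hQy]
    · rw [Set.indicator_of_notMem (fun h => hy (hmem.mp h)), Set.indicator_of_notMem hy, ENNReal.ofReal_zero, zero_mul]
  have hright : ∀ y : EuclideanSpace ℝ I,
      ENNReal.ofReal (cutoffBoltzmann H I p (fun x => if h : x ∈ I then (ofLp y : I → ℝ) ⟨x, h⟩ else 0)) =
        ENNReal.ofReal (boxW.indicator (fun w' => Real.exp (H (fun x => if h : x ∈ I then w' ⟨x, h⟩ else 0))) (ofLp y)) := by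
    intro y
    rw [cutoffBoltzmann_ext_eq_indicator I hp H]
  simp_rw [hleft, hright]
  exact lintegral_mul_gaussWeight_tilt_eq hS hA₁ hGm

/-- ★★★ **THE TILTED REGION-BOX INTEGRAL UNDER ONE LAW IS THE ROAD'S CUT-OFF INTEGRAL** (Bochner currency, the constant inside the
exponent).  With `c = log(Z_S/Z_{A₁})` (`Z_P = ∫ e^{−½⟨y,Py⟩}dy`, both finite and positive):
`∫ 𝟙{∀x∈I, |z_x| ≤ p}·e^{H + Q + c} d𝒩(0,K) = ∫ Π_Δχ̂^I_pΔ e^{H} d𝒩(0,K₁)` — print's `∫ χ e^{𝒱} dμ_{C^{(k)}}` for the region member `A₁ = C^{(k)}(h,U)⁻¹`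
is presented EXACTLY by the h-independent law `𝒩(0,K)` with the potential `𝒱 := H + Q + c` reading region variables only.
[cite: Balaban1985UV3, (58) p.270, (24) p.262; BenfattoEtAl1978, (4.6)–(4.7) p.152 (class form; ours)] -/
theorem integral_printBox_exp_tilt_eq (hA : A.PosDef) (hI : I ⊆ Λ₀) (hA₁ : A₁.PosDef)
    {H : (B1Eq324BenfattoLemma.Site d → ℝ) → ℝ} (hHm : Measurable H)
    (hHloc : ∀ z z', (∀ x ∈ I, z x = z' x) → H z = H z') {p : ℝ} (hp : 0 ≤ p)
    {Q : (B1Eq324BenfattoLemma.Site d → ℝ) → ℝ}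
    (hQ : ∀ z, Q z = -(1 / 2) * ∑ u : I, ∑ v : I, (A₁ u v - (covGram K I)⁻¹ u v) * z u * z v) :
    ∫ z, {z : B1Eq324BenfattoLemma.Site d → ℝ | ∀ x ∈ I, |z x| ≤ p}.indicator
        (fun z => Real.exp (H z + Q z + Real.log ((gaussZ (covGram K I)⁻¹).toReal / (gaussZ A₁).toReal))) z
        ∂gaussianFieldOfKernel K =
      ∫ z, cutoffBoltzmann H I p z ∂gaussianFieldOfKernel K₁ := by
  set S : Matrix I I ℝ := (covGram K I)⁻¹ with hSdef
  have hS : S.PosDef := posDef_inv_covGram hK hA hI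
  obtain ⟨-, hZS0, hZStop⟩ := multivariateGaussian_inv_eq_withDensity hS
  obtain ⟨-, hZ0, hZtop⟩ := multivariateGaussian_inv_eq_withDensity hA₁
  have hZSpos : 0 < (gaussZ S).toReal := ENNReal.toReal_pos hZS0 hZStop
  have hZpos : 0 < (gaussZ A₁).toReal := ENNReal.toReal_pos hZ0 hZtop
  set c : ℝ := Real.log ((gaussZ S).toReal / (gaussZ A₁).toReal) with hcdef
  have hc : Real.exp c = (gaussZ S).toReal / (gaussZ A₁).toReal := Real.exp_log (div_pos hZSpos hZpos)
  set box : Set (B1Eq324BenfattoLemma.Site d → ℝ) := {z | ∀ x ∈ I, |z x| ≤ p} with hbox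
  have hsplit : ∀ z, box.indicator (fun z => Real.exp (H z + Q z + c)) z =
      Real.exp c * box.indicator (fun z => Real.exp (H z + Q z)) z := by
    intro z
    by_cases hz : z ∈ box
    · rw [Set.indicator_of_mem hz, Set.indicator_of_mem hz, Real.exp_add, mul_comm]
    · rw [Set.indicator_of_notMem hz, Set.indicator_of_notMem hz, mul_zero]
  simp_rw [hsplit]
  rw [integral_const_mul]
  have hQm : Measurable Q := measurable_tilt hQ
  have hf0 : ∀ z, 0 ≤ box.indicator (fun z => Real.exp (H z + Q z)) z := fun z =>
    Set.indicator_nonneg (fun _ _ => (Real.exp_pos _).le) z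
  have hfm : Measurable (box.indicator fun z => Real.exp (H z + Q z)) :=
    ((hHm.add hQm).exp).indicator (measurableSet_printBox I p)
  have hg0 : ∀ z, 0 ≤ cutoffBoltzmann H I p z := fun z => by
    unfold cutoffBoltzmann
    exact Set.indicator_nonneg (fun _ _ => (Real.exp_pos _).le) z
  have hgm : Measurable (cutoffBoltzmann H I p) := by
    unfold cutoffBoltzmann
    exact hHm.exp.indicator (measurableSet_smallFieldSet I p)
  rw [integral_eq_lintegral_of_nonneg_ae (Filter.Eventually.of_forall hf0) hfm.aestronglyMeasurable,
    integral_eq_lintegral_of_nonneg_ae (Filter.Eventually.of_forall hg0) hgm.aestronglyMeasurable,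
    lintegral_printBox_tilt_eq_mul hK hK₁ hA hI hA₁ hHm hHloc hp hQ, ENNReal.toReal_mul, ENNReal.toReal_mul,
    ENNReal.toReal_inv, hc]
  have hZSne : (gaussZ S).toReal ≠ 0 := hZSpos.ne'
  have hZne : (gaussZ A₁).toReal ≠ 0 := hZpos.ne'
  generalize (∫⁻ z, ENNReal.ofReal (cutoffBoltzmann H I p z) ∂gaussianFieldOfKernel K₁).toReal = L
  calc (gaussZ S).toReal / (gaussZ A₁).toReal * (((gaussZ S).toReal)⁻¹ * (gaussZ A₁).toReal * L)
      = ((gaussZ S).toReal * ((gaussZ S).toReal)⁻¹) * ((gaussZ A₁).toReal / (gaussZ A₁).toReal) * L := by ring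
    _ = L := by rw [mul_inv_cancel₀ hZSne, div_self hZne, one_mul, one_mul]

/-- ★★★ **THE SAME FOR THE INTERACTION `H_J` OF (4.5)** supported in the region (`J ⊆ I`): the tilted region-box integral of
`e^{H_J + Q + c}` under ONE law `𝒩(0,K)` equals the road's `∫ Π_Δχ̂^I_pΔ e^{H_J} d𝒩(0,K₁)` for the region member `(I, A₁, K₁)`.
[cite: Balaban1985UV3, (58) p.270, (56) p.269, (57) p.270; BenfattoEtAl1978, (4.5)–(4.7) p.152 (class form; ours)] -/
theorem integral_printBox_exp_tilt_hamiltonian_eq (hA : A.PosDef) (hI : I ⊆ Λ₀) (hA₁ : A₁.PosDef)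
    (s D : ℕ) (ϰ : ℝ) (a : Coef d) {J : Finset (B1Eq324BenfattoLemma.Site d)} (hJ : J ⊆ I) {p : ℝ} (hp : 0 ≤ p)
    {Q : (B1Eq324BenfattoLemma.Site d → ℝ) → ℝ}
    (hQ : ∀ z, Q z = -(1 / 2) * ∑ u : I, ∑ v : I, (A₁ u v - (covGram K I)⁻¹ u v) * z u * z v) :
    ∫ z, {z : B1Eq324BenfattoLemma.Site d → ℝ | ∀ x ∈ I, |z x| ≤ p}.indicator
        (fun z => Real.exp (hamiltonian s D ϰ a J z + Q z +
          Real.log ((gaussZ (covGram K I)⁻¹).toReal / (gaussZ A₁).toReal))) z ∂gaussianFieldOfKernel K =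
      ∫ z, cutoffBoltzmann (hamiltonian s D ϰ a J) I p z ∂gaussianFieldOfKernel K₁ :=
  integral_printBox_exp_tilt_eq hK hK₁ hA hI hA₁ (measurable_hamiltonian J)
    (fun _ _ h => hamiltonian_congr_eqOn J fun x hx => h x (hJ hx)) hp hQ

/-- ★★ **(3.24) TRANSPORTS VERBATIM**: the road's conclusion for the region member `(I, A₁, K₁)` —
`0 < ∫ Π_Δχ̂^I_pΔ e^{H_J} d𝒩(0,K₁)` and `|log ∫ … − Σ_{n≤t} ℰ^T(H_J; n)/n!| ≤ E`, cumulants under `𝒩(0,K₁)` — IS the same sentence for the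
tilted region-box integral under the one law `𝒩(0,K)` (the integrals are equal; the cumulant letter is untouched).
[cite: Balaban1982Higgs1, (3.24) p.616; Balaban1985UV3, (24) p.262, (58) p.270 (class form; ours)] -/
theorem eq324Shape_tilt_iff (hA : A.PosDef) (hI : I ⊆ Λ₀) (hA₁ : A₁.PosDef)
    (s D : ℕ) (ϰ : ℝ) (a : Coef d) {J : Finset (B1Eq324BenfattoLemma.Site d)} (hJ : J ⊆ I) {p : ℝ} (hp : 0 ≤ p)
    {Q : (B1Eq324BenfattoLemma.Site d → ℝ) → ℝ}
    (hQ : ∀ z, Q z = -(1 / 2) * ∑ u : I, ∑ v : I, (A₁ u v - (covGram K I)⁻¹ u v) * z u * z v) (t : ℕ) (E : ℝ) :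
    (0 < ∫ z, {z : B1Eq324BenfattoLemma.Site d → ℝ | ∀ x ∈ I, |z x| ≤ p}.indicator
          (fun z => Real.exp (hamiltonian s D ϰ a J z + Q z +
            Real.log ((gaussZ (covGram K I)⁻¹).toReal / (gaussZ A₁).toReal))) z ∂gaussianFieldOfKernel K ∧
      |Real.log (∫ z, {z : B1Eq324BenfattoLemma.Site d → ℝ | ∀ x ∈ I, |z x| ≤ p}.indicator
          (fun z => Real.exp (hamiltonian s D ϰ a J z + Q z +
            Real.log ((gaussZ (covGram K I)⁻¹).toReal / (gaussZ A₁).toReal))) z ∂gaussianFieldOfKernel K) -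
        cumulantSum (gaussianFieldOfKernel K₁) (hamiltonian s D ϰ a J) t| ≤ E) ↔
    (0 < ∫ z, cutoffBoltzmann (hamiltonian s D ϰ a J) I p z ∂gaussianFieldOfKernel K₁ ∧
      |Real.log (∫ z, cutoffBoltzmann (hamiltonian s D ϰ a J) I p z ∂gaussianFieldOfKernel K₁) -
        cumulantSum (gaussianFieldOfKernel K₁) (hamiltonian s D ϰ a J) t| ≤ E) := by
  rw [integral_printBox_exp_tilt_hamiltonian_eq hK hK₁ hA hI hA₁ s D ϰ a hJ hp hQ]

end Composite

/-! ## §5  Seat n08-b's END restated: ONE full-window law, the class rows asked of the region member only -/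

section End

/-- ★★ **[Balaban1982Higgs1] (3.24) FOR THE TILTED REGION-BOX INTEGRAL UNDER ONE LAW, all `η ∈ (0,1]`, window `b₁ < b₀`.**
Class scalars `(d, γ_A, K_A, κ_A, t, D, ϰ, p₀, σ, c, κ)` FIRST (`κ < σ(t+1)`, `p₀ > 2/3`); then `∃ b₁ ∀ b₀ > b₁ ∃ C ≥ 0 ∀ η ∈ (0,1]`, for EVERY
positive definite `A` on any `Λ₀` with zero-extended inverse `K` (ONE law — no class row asked of `A`), EVERY region `∅ ≠ I ⊆ Λ₀`, EVERY region
member `(I, A₁, K₁)` in the class (`A₁` symmetric, `γ_A`-coercive, `|A₁ e e′| ≤ K_A e^{−κ_A|e−e′|₂}`), every `H_J` of (4.5) with `J ⊆ I` and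
`sup|coeff| ≤ c·η^σ`, and the tilt `Q = −½⟨z,(A₁ − (K_{II})⁻¹)z⟩_I`:
`0 < ∫ 𝟙{∀x∈I, |z_x| ≤ p_{b₀}(η)} e^{H_J + Q + log(Z_S/Z_{A₁})} d𝒩(0,K)` and
`|log ∫ … − Σ_{n≤t} ℰ^T_{𝒩(0,K₁)}(H_J; n)/n!| ≤ C·η^κ·|I|` — seat n08-b's `…KernelEq324AnyGammaUnitRange.eq324_kernel_of_expDecay_on_unit` at the
member `(I, A₁, K₁)`, transported by `eq324Shape_tilt_iff`.
[cite: Balaban1982Higgs1, (3.24) p.616; Balaban1985UV3, (24) p.262, (58) p.270; BenfattoEtAl1978, Lemma p.152 (class form; ours)] -/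
theorem eq324_tilt_of_expDecay_on_unit (hd : 0 < d) {γA KA κA : ℝ} (hγA0 : 0 < γA) (hKA : 0 ≤ KA) (hκA : 0 < κA)
    (t D : ℕ) {ϰ : ℝ} (hϰ : 0 < ϰ) {p₀ σ c κ : ℝ} (hp₀ : 2 / 3 < p₀) (hσ : 0 < σ) (hc : 0 ≤ c) (hκ : 0 < κ)
    (hκσ : κ < σ * (t + 1)) :
    ∃ b₁ : ℝ, ∀ b₀ : ℝ, b₁ < b₀ → ∃ C : ℝ, 0 ≤ C ∧ ∀ η : ℝ, 0 < η → η ≤ 1 →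
      ∀ {Λ₀ : Finset (B1Eq324BenfattoLemma.Site d)} {A : Matrix Λ₀ Λ₀ ℝ}
        {K : B1Eq324BenfattoLemma.Site d → B1Eq324BenfattoLemma.Site d → ℝ},
        (∀ x y, K x y = if h : x ∈ Λ₀ ∧ y ∈ Λ₀ then (A⁻¹ : Matrix Λ₀ Λ₀ ℝ) ⟨x, h.1⟩ ⟨y, h.2⟩ else 0) → A.PosDef →
      ∀ {I : Finset (B1Eq324BenfattoLemma.Site d)} {A₁ : Matrix I I ℝ}
        {K₁ : B1Eq324BenfattoLemma.Site d → B1Eq324BenfattoLemma.Site d → ℝ},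
        (∀ x y, K₁ x y = if h : x ∈ I ∧ y ∈ I then (A₁⁻¹ : Matrix I I ℝ) ⟨x, h.1⟩ ⟨y, h.2⟩ else 0) →
        I ⊆ Λ₀ → I.Nonempty → (∀ e e', A₁ e e' = A₁ e' e) →
        (∀ x : I → ℝ, γA * ∑ e, x e ^ 2 ≤ ∑ e, ∑ e', A₁ e e' * x e * x e') →
        (∀ e e' : I, |A₁ e e'| ≤ KA * Real.exp (-(κA * Real.sqrt (∑ j,
          ((((e : B1Eq324BenfattoLemma.Site d) j : ℝ) - ((e' : B1Eq324BenfattoLemma.Site d) j : ℝ))) ^ 2)))) →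
        ∀ (s : ℕ) (J : Finset (B1Eq324BenfattoLemma.Site d)) (a : Coef d), J ⊆ I → coefSup s D a J ≤ c * η ^ σ →
        ∀ {Q : (B1Eq324BenfattoLemma.Site d → ℝ) → ℝ},
          (∀ z, Q z = -(1 / 2) * ∑ u : I, ∑ v : I, (A₁ u v - (covGram K I)⁻¹ u v) * z u * z v) →
          0 < ∫ z, {z : B1Eq324BenfattoLemma.Site d → ℝ | ∀ x ∈ I, |z x| ≤ B10.pFun b₀ p₀ η}.indicator
              (fun z => Real.exp (hamiltonian s D ϰ a J z + Q z +
                Real.log ((gaussZ (covGram K I)⁻¹).toReal / (gaussZ A₁).toReal))) z ∂gaussianFieldOfKernel K ∧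
          |Real.log (∫ z, {z : B1Eq324BenfattoLemma.Site d → ℝ | ∀ x ∈ I, |z x| ≤ B10.pFun b₀ p₀ η}.indicator
              (fun z => Real.exp (hamiltonian s D ϰ a J z + Q z +
                Real.log ((gaussZ (covGram K I)⁻¹).toReal / (gaussZ A₁).toReal))) z ∂gaussianFieldOfKernel K) -
            cumulantSum (gaussianFieldOfKernel K₁) (hamiltonian s D ϰ a J) t| ≤ C * η ^ κ * I.card := by
  obtain ⟨b₁, hb₁⟩ := eq324_kernel_of_expDecay_on_unit hd hγA0 hKA hκA t D hϰ hp₀ hσ hc hκ hκσ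
  refine ⟨max b₁ 0, fun b₀ hb₀ => ?_⟩
  obtain ⟨C, hC0, hC⟩ := hb₁ b₀ (lt_of_le_of_lt (le_max_left _ _) hb₀)
  refine ⟨C, hC0, fun η hη hη1 Λ₀ A K hK hA I A₁ K₁ hK₁ hI hIne hA₁s hγ hdec s J a hJ hcoef Q hQ => ?_⟩
  have hb₀0 : 0 ≤ b₀ := (le_max_right b₁ 0).trans hb₀.le
  have hp : 0 ≤ B10.pFun b₀ p₀ η := B10.pFun_nonneg b₀ p₀ η hb₀0 hη hη1
  have hA₁ : A₁.PosDef := posDef_of_coercive hA₁s hγA0 hγ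
  rw [eq324Shape_tilt_iff hK hK₁ hA hI hA₁ s D ϰ a hJ hp hQ]
  exact hC η hη hη1 hK₁ hIne hA₁s hγ hdec s I J a hIne hJ hJ hcoef

/-- **Coercivity passes to a principal block along ANY injective index map**, with the same constant (extend by zero along the map).
[cite: HornJohnson2013, Thm 4.3.28 (interlacing; lower bound only)] -/
theorem coercive_submatrix_of_injective {ι m : Type*} [Fintype ι] [Fintype m] [DecidableEq ι]
    {A : Matrix ι ι ℝ} {γ : ℝ} (hγ : ∀ x : ι → ℝ, γ * ∑ e, x e ^ 2 ≤ ∑ e, ∑ e', A e e' * x e * x e')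
    {f : m → ι} (hf : Function.Injective f) (z : m → ℝ) :
    γ * ∑ s, z s ^ 2 ≤ ∑ s, ∑ s', A (f s) (f s') * z s * z s' := by
  classical
  -- extend `z` by zero along `f`
  set x : ι → ℝ := fun i => ∑ s, if f s = i then z s else 0 with hx
  have hsum : ∀ g : ι → ℝ, ∑ i, g i * x i = ∑ s, g (f s) * z s := by
    intro g
    simp only [hx, Finset.mul_sum]
    rw [Finset.sum_comm]
    refine Finset.sum_congr rfl fun s _ => ?_
    rw [Finset.sum_eq_single (f s)]
    · rw [if_pos rfl]
    · intro i _ hi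
      rw [if_neg (Ne.symm hi), mul_zero]
    · intro h
      exact absurd (Finset.mem_univ _) h
  have hxf : ∀ s, x (f s) = z s := by
    intro s
    show (∑ s', if f s' = f s then z s' else 0) = z s
    rw [Finset.sum_eq_single s]
    · rw [if_pos rfl]
    · intro s' _ hs'
      rw [if_neg (fun h' => hs' (hf h'))]
    · intro h'
      exact absurd (Finset.mem_univ _) h'
  have h1 : ∑ i, x i ^ 2 = ∑ s, z s ^ 2 := by
    have h := hsum x
    simp_rw [sq]
    rw [h]
    exact Finset.sum_congr rfl fun s _ => by rw [hxf]
  have h2 : ∑ i, ∑ j, A i j * x i * x j = ∑ s, ∑ s', A (f s) (f s') * z s * z s' := by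
    have inner : ∀ i, ∑ j, A i j * x i * x j = (∑ s', A i (f s') * z s') * x i := by
      intro i
      rw [← hsum (fun j => A i j), Finset.sum_mul]
      exact Finset.sum_congr rfl fun j _ => by ring
    simp_rw [inner]
    rw [hsum (fun i => ∑ s', A i (f s') * z s')]
    refine Finset.sum_congr rfl fun s _ => ?_
    rw [Finset.sum_mul]
    exact Finset.sum_congr rfl fun s' _ => by ring
  have h := hγ x
  rw [h1, h2] at h
  exact h

/-- ★★★ **ONE CLASS MEMBER PRESENTS (3.24) FOR ALL ITS REGIONS.**  Class scalars first; then `∃ b₁ ∀ b₀ > b₁ ∃ C ≥ 0 ∀ η ∈ (0,1]`: for EVERY class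
member `(Λ₀, A, K)` on `ℤ^d` (`A` symmetric, `γ_A`-coercive, `|A e e′| ≤ K_A e^{−κ_A|e−e′|₂}`) and EVERY region `∅ ≠ I ⊆ Λ₀`, with the REGION MEMBER
`A|_I` (principal block — it inherits the three rows with the same constants: `coercive_submatrix_of_injective`) and its zero-extended inverse `K₁`, every
`H_J` (`J ⊆ I`, `sup|coeff| ≤ c·η^σ`) and the tilt `Q = −½⟨z,(A|_I − (K_{II})⁻¹)z⟩_I`:
`0 < ∫ 𝟙{∀x∈I, |z_x| ≤ p_{b₀}(η)} e^{H_J + Q + log(Z_S/Z_{A|_I})} d𝒩(0,K)` and `|log ∫ … − Σ_{n≤t}ℰ^T_{𝒩(0,K₁)}(H_J;n)/n!| ≤ C·η^κ·|I|`.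
At the printed ZERO BACKGROUND this is UNCONDITIONAL: take `(Λ₀, A, K)` = the gauge-field fluctuation precision `C*Δ_kC` of [Balaban1984PropagatorsII] (2.155)
on ALL free bond variables of the unit torus, presented on its bent window (seat n08-d's `…ClassTorusGaugeFluctuation.torusGauge_presentation` supplies the
three rows from `(d, L)` only) — ONE law per step, every region `Λ_{k+1}(h)` served by its principal block, as in [Balaban1985UV3] (58).
[cite: Balaban1982Higgs1, (3.24) p.616; Balaban1985UV3, (22) p.261, (24) p.262, (58) p.270; Balaban1984PropagatorsII, (2.155) p.250;
BenfattoEtAl1978, Lemma p.152 (class form; ours)] -/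
theorem eq324_tilt_submatrix_of_expDecay_on_unit (hd : 0 < d) {γA KA κA : ℝ} (hγA0 : 0 < γA) (hKA : 0 ≤ KA) (hκA : 0 < κA)
    (t D : ℕ) {ϰ : ℝ} (hϰ : 0 < ϰ) {p₀ σ c κ : ℝ} (hp₀ : 2 / 3 < p₀) (hσ : 0 < σ) (hc : 0 ≤ c) (hκ : 0 < κ)
    (hκσ : κ < σ * (t + 1)) :
    ∃ b₁ : ℝ, ∀ b₀ : ℝ, b₁ < b₀ → ∃ C : ℝ, 0 ≤ C ∧ ∀ η : ℝ, 0 < η → η ≤ 1 →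
      ∀ {Λ₀ : Finset (B1Eq324BenfattoLemma.Site d)} {A : Matrix Λ₀ Λ₀ ℝ}
        {K : B1Eq324BenfattoLemma.Site d → B1Eq324BenfattoLemma.Site d → ℝ},
        (∀ x y, K x y = if h : x ∈ Λ₀ ∧ y ∈ Λ₀ then (A⁻¹ : Matrix Λ₀ Λ₀ ℝ) ⟨x, h.1⟩ ⟨y, h.2⟩ else 0) →
        (∀ e e', A e e' = A e' e) → (∀ x : Λ₀ → ℝ, γA * ∑ e, x e ^ 2 ≤ ∑ e, ∑ e', A e e' * x e * x e') →
        (∀ e e' : Λ₀, |A e e'| ≤ KA * Real.exp (-(κA * Real.sqrt (∑ j,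
          ((((e : B1Eq324BenfattoLemma.Site d) j : ℝ) - ((e' : B1Eq324BenfattoLemma.Site d) j : ℝ))) ^ 2)))) →
      ∀ {I : Finset (B1Eq324BenfattoLemma.Site d)} (hI : I ⊆ Λ₀), I.Nonempty →
      ∀ {K₁ : B1Eq324BenfattoLemma.Site d → B1Eq324BenfattoLemma.Site d → ℝ},
        (∀ x y, K₁ x y = if h : x ∈ I ∧ y ∈ I then
          ((A.submatrix (fun j : ↥I => (⟨j, hI j.2⟩ : ↥Λ₀)) (fun j : ↥I => (⟨j, hI j.2⟩ : ↥Λ₀)))⁻¹ : Matrix I I ℝ)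
            ⟨x, h.1⟩ ⟨y, h.2⟩ else 0) →
        ∀ (s : ℕ) (J : Finset (B1Eq324BenfattoLemma.Site d)) (a : Coef d), J ⊆ I → coefSup s D a J ≤ c * η ^ σ →
        ∀ {Q : (B1Eq324BenfattoLemma.Site d → ℝ) → ℝ},
          (∀ z, Q z = -(1 / 2) * ∑ u : I, ∑ v : I,
            ((A.submatrix (fun j : ↥I => (⟨j, hI j.2⟩ : ↥Λ₀)) (fun j : ↥I => (⟨j, hI j.2⟩ : ↥Λ₀))) u v -
              (covGram K I)⁻¹ u v) * z u * z v) →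
          0 < ∫ z, {z : B1Eq324BenfattoLemma.Site d → ℝ | ∀ x ∈ I, |z x| ≤ B10.pFun b₀ p₀ η}.indicator
              (fun z => Real.exp (hamiltonian s D ϰ a J z + Q z +
                Real.log ((gaussZ (covGram K I)⁻¹).toReal /
                  (gaussZ (A.submatrix (fun j : ↥I => (⟨j, hI j.2⟩ : ↥Λ₀)) (fun j : ↥I => (⟨j, hI j.2⟩ : ↥Λ₀)))).toReal))) z
              ∂gaussianFieldOfKernel K ∧
          |Real.log (∫ z, {z : B1Eq324BenfattoLemma.Site d → ℝ | ∀ x ∈ I, |z x| ≤ B10.pFun b₀ p₀ η}.indicator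
              (fun z => Real.exp (hamiltonian s D ϰ a J z + Q z +
                Real.log ((gaussZ (covGram K I)⁻¹).toReal /
                  (gaussZ (A.submatrix (fun j : ↥I => (⟨j, hI j.2⟩ : ↥Λ₀)) (fun j : ↥I => (⟨j, hI j.2⟩ : ↥Λ₀)))).toReal))) z
              ∂gaussianFieldOfKernel K) -
            cumulantSum (gaussianFieldOfKernel K₁) (hamiltonian s D ϰ a J) t| ≤ C * η ^ κ * I.card := by
  obtain ⟨b₁, hb₁⟩ := eq324_tilt_of_expDecay_on_unit (d := d) hd hγA0 hKA hκA t D hϰ hp₀ hσ hc hκ hκσ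
  refine ⟨b₁, fun b₀ hb₀ => ?_⟩
  obtain ⟨C, hC0, hC⟩ := hb₁ b₀ hb₀
  refine ⟨C, hC0, fun η hη hη1 Λ₀ A K hK hAs hγ hdec I hI hIne K₁ hK₁ s J a hJ hcoef Q hQ => ?_⟩
  have hinj : Function.Injective (fun j : ↥I => (⟨j, hI j.2⟩ : ↥Λ₀)) := fun a b hab =>
    Subtype.ext (by simpa using congrArg Subtype.val hab)
  exact hC η hη hη1 hK (posDef_of_coercive hAs hγA0 hγ) hK₁ hI hIne (fun e e' => hAs _ _)
    (fun x => coercive_submatrix_of_injective hγ hinj x) (fun e e' => hdec _ _) s J a hJ hcoef hQ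

end End


/-! ## §6 (v1.1, APPEND-ONLY)  The `η₀`-window edition of the tilted END -/

section EndEta0

open Literature.MathematicalPhysics.QuantumFieldTheory.Balaban1983to89.B1Eq324BenfattoKernelEq324AnyGamma (eq324_kernel_of_expDecay)

/-- ★★ **THE TILTED REGION-BOX (3.24) UNDER ONE LAW — `η₀`-WINDOW EDITION** (fixed `b₀ > 0`; `∃ η₀ ∈ (0,1]`, `C ≥ 0`, `∀ η ≤ η₀`): for EVERY positive definite
`A` on any `Λ₀` with zero-extended inverse `K`, EVERY region `∅ ≠ I ⊆ Λ₀`, EVERY region member `(I, A₁, K₁)` in the class, every `H_J` (`J ⊆ I`,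
`sup|coeff| ≤ c·η^σ`) and the tilt `Q = −½⟨z,(A₁ − (K_{II})⁻¹)z⟩_I`: `0 < ∫ 𝟙{∀x∈I, |z_x| ≤ p_{b₀}(η)} e^{H_J + Q + log(Z_S/Z_{A₁})} d𝒩(0,K)` and
`|log ∫ … − Σ_{n≤t} ℰ^T_{𝒩(0,K₁)}(H_J; n)/n!| ≤ C·η^κ·|I|` — seat n08-b's `…KernelEq324AnyGamma.eq324_kernel_of_expDecay` at the member `(I, A₁, K₁)`,
transported by `eq324Shape_tilt_iff`.
[cite: Balaban1982Higgs1, (3.24) p.616; Balaban1985UV3, (24) p.262, (58) p.270; BenfattoEtAl1978, Lemma p.152 (class form; ours)] -/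
theorem eq324_tilt_of_expDecay (hd : 0 < d) {γA KA κA : ℝ} (hγA0 : 0 < γA) (hKA : 0 ≤ KA) (hκA : 0 < κA)
    (t D : ℕ) {ϰ : ℝ} (hϰ : 0 < ϰ) {b₀ p₀ σ c κ : ℝ} (hb₀ : 0 < b₀) (hp₀ : 2 / 3 < p₀) (hσ : 0 < σ) (hc : 0 ≤ c) (hκ : 0 < κ)
    (hκσ : κ < σ * (t + 1)) :
    ∃ η₀ C : ℝ, 0 < η₀ ∧ η₀ ≤ 1 ∧ 0 ≤ C ∧ ∀ η : ℝ, 0 < η → η ≤ η₀ →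
      ∀ {Λ₀ : Finset (B1Eq324BenfattoLemma.Site d)} {A : Matrix Λ₀ Λ₀ ℝ}
        {K : B1Eq324BenfattoLemma.Site d → B1Eq324BenfattoLemma.Site d → ℝ},
        (∀ x y, K x y = if h : x ∈ Λ₀ ∧ y ∈ Λ₀ then (A⁻¹ : Matrix Λ₀ Λ₀ ℝ) ⟨x, h.1⟩ ⟨y, h.2⟩ else 0) → A.PosDef →
      ∀ {I : Finset (B1Eq324BenfattoLemma.Site d)} {A₁ : Matrix I I ℝ}
        {K₁ : B1Eq324BenfattoLemma.Site d → B1Eq324BenfattoLemma.Site d → ℝ},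
        (∀ x y, K₁ x y = if h : x ∈ I ∧ y ∈ I then (A₁⁻¹ : Matrix I I ℝ) ⟨x, h.1⟩ ⟨y, h.2⟩ else 0) →
        I ⊆ Λ₀ → I.Nonempty → (∀ e e', A₁ e e' = A₁ e' e) →
        (∀ x : I → ℝ, γA * ∑ e, x e ^ 2 ≤ ∑ e, ∑ e', A₁ e e' * x e * x e') →
        (∀ e e' : I, |A₁ e e'| ≤ KA * Real.exp (-(κA * Real.sqrt (∑ j,
          ((((e : B1Eq324BenfattoLemma.Site d) j : ℝ) - ((e' : B1Eq324BenfattoLemma.Site d) j : ℝ))) ^ 2)))) →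
        ∀ (s : ℕ) (J : Finset (B1Eq324BenfattoLemma.Site d)) (a : Coef d), J ⊆ I → coefSup s D a J ≤ c * η ^ σ →
        ∀ {Q : (B1Eq324BenfattoLemma.Site d → ℝ) → ℝ},
          (∀ z, Q z = -(1 / 2) * ∑ u : I, ∑ v : I, (A₁ u v - (covGram K I)⁻¹ u v) * z u * z v) →
          0 < ∫ z, {z : B1Eq324BenfattoLemma.Site d → ℝ | ∀ x ∈ I, |z x| ≤ B10.pFun b₀ p₀ η}.indicator
              (fun z => Real.exp (hamiltonian s D ϰ a J z + Q z +
                Real.log ((gaussZ (covGram K I)⁻¹).toReal / (gaussZ A₁).toReal))) z ∂gaussianFieldOfKernel K ∧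
          |Real.log (∫ z, {z : B1Eq324BenfattoLemma.Site d → ℝ | ∀ x ∈ I, |z x| ≤ B10.pFun b₀ p₀ η}.indicator
              (fun z => Real.exp (hamiltonian s D ϰ a J z + Q z +
                Real.log ((gaussZ (covGram K I)⁻¹).toReal / (gaussZ A₁).toReal))) z ∂gaussianFieldOfKernel K) -
            cumulantSum (gaussianFieldOfKernel K₁) (hamiltonian s D ϰ a J) t| ≤ C * η ^ κ * I.card := by
  obtain ⟨η₀, C, hη₀, hη₀1, hC0, hC⟩ := eq324_kernel_of_expDecay hd hγA0 hKA hκA t D hϰ hb₀ hp₀ hσ hc hκ hκσ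
  refine ⟨η₀, C, hη₀, hη₀1, hC0, fun η hη hηle Λ₀ A K hK hA I A₁ K₁ hK₁ hI hIne hA₁s hγ hdec s J a hJ hcoef Q hQ => ?_⟩
  have hp : 0 ≤ B10.pFun b₀ p₀ η := B10.pFun_nonneg b₀ p₀ η hb₀.le hη (hηle.trans hη₀1)
  have hA₁ : A₁.PosDef := posDef_of_coercive hA₁s hγA0 hγ
  rw [eq324Shape_tilt_iff hK hK₁ hA hI hA₁ s D ϰ a hJ hp hQ]
  exact hC η hη hηle hK₁ hIne hA₁s hγ hdec s I J a hIne hJ hJ hcoef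

end EndEta0

end Literature.MathematicalPhysics.QuantumFieldTheory.Balaban1983to89.B1Eq324BenfattoClassMarginalTilt
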